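import Literature.IUT.LogVolume.PrimeNumberEstimates
import Literature.IUT.LogVolume.Theorem110Data
import HarnessLib

/-!
# [IUTchIV] Theorem 1.10 (Log-volume Estimates for Θ-Pilot Objects): Step (viii), `C_Θ` as printed,
# and the displayed inequalities

Mochizuki, *Inter-universal Teichmüller theory IV*, RIMS manuscript (Apr. 2020; = PRIMS **57**
(2021)), Theorem 1.10, statement pp. 22–23, proof pp. 23–31; this file does Step (viii) (pp. 30–31) and
the last paragraph of the proof. TAKES NO SIDE on the disputed step ([IUTchIII] Cor. 3.12 is the
HYPOTHESIS `Thm110Numerics.Cor312`, never asserted). Data, `C_Θ`, `ProofData`, Steps (i)–(iii):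
`Theorem110Data.lean`; the averaging of Steps (v)–(viii): `Theorem110LocalBounds.lean`; Prop. 1.6 (the
prime number theorem, PROVED in the tree): `PrimeNumberEstimates.lean` — so `η_prm` enters through the
predicate `IsEtaPrm`, literally as "the positive real number of Proposition 1.6", not as a named fact.

Main results (namespace `Literature.IUT.LogVolume.Thm110Numerics`):
* `cThetaAdmissible_of_proofData` — from the proof data: `−|log(Θ)| ≤ C_Θ·|log(q)|` with
  `C_Θ = (l+1)/(4·|log(q)|)·{(1 + 12·d_mod/l)·(log(𝔡^{F_tpd}) + log(𝔣^{F_tpd})) + 10·(e*_mod·l + η_prm)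
  − (1/6)·(1 − 12/l²)·log(q)} − 1` VERBATIM (p. 23), i.e. "one may take the constant `C_Θ` … to be" it;
* `neg_one_le_CTheta` — WITH the hypothesis `Cor312` ("`C_Θ ≥ −1`", [IUTchIII] Cor. 3.12): `−1 ≤ C_Θ`;
* `display_of_neg_one_le_CTheta` — `C_Θ ≥ −1 ⟹ (1/6)·log(q) ≤ (1 + 20·d_mod/l)·(log(𝔡^{F_tpd}) +
  log(𝔣^{F_tpd})) + 20·(e*_mod·l + η_prm)` (last paragraph of the proof, p. 31, needs `l ≥ 7`, `d_mod ≥ 1`);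
* `theorem110` — the whole chain: proof data + `IsEtaPrm η_prm` + `Cor312` + `l ≠ 5` ⟹ both displayed
  inequalities of Theorem 1.10 (the second via Step (ii)'s `log(𝔡^{F_tpd}) + log(𝔣^{F_tpd}) ≤ log(𝔡^F) + log(𝔣^F)`).

The kernel reproduces every printed numerical step of Step (viii): the `56`,
`(l+1)/4·(1/6)·(12/l²) ≥ 1/(2l)`, `l*_mod·log(𝔰^≤) ≤ (4/3)·(e*_mod·l + η_prm)` (Prop. 1.6),
`(1/3)·(4/3)·(e*_mod·l + η_prm) ≥ 2·log(l) + 56`, the absorption into the printed `10`, `(1 − 12/l²)⁻¹ ≤ 2`,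
`(1 − 12/l²)⁻¹·(1 + 12·d_mod/l) ≤ 1 + 20·d_mod/l` (this last one is FALSE at `l = 5`, which is why the display
needs the printed "`l ≠ 5`", i.e. `l ≥ 7` — cf. `Summit.ABC.IUTFork.Thm110Data.coeff_step_fails_at_five` in
the cell's fork skeleton, which this Literature file does not import).

Deliberately NOT here: see `Theorem110Data.lean`; the construction of initial Θ-data (Cor. 2.2).
-/

noncomputable section

namespace Literature.IUT.LogVolume

open Real
open scoped Nat.Prime

namespace Thm110Numerics

variable {X : Thm110Numerics}

/-! ## Step (viii) (pp. 30–31) -/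

/-- Step (viii), first display (p. 30): summing the local procession-normalized bounds of Steps (v),
(vi), (vii) over `v_ℚ ∈ 𝕍_ℚ` and applying the final display of Step (iii) gives the upper bound
`(l+1)/4·{(1 + 12·d_mod/l)·(log(𝔡^{F_tpd}) + log(𝔣^{F_tpd})) + 2·log(l) + 56 − (1/6)·(1 − 12/l²)·log(q)
+ (20/3)·l*_mod·log(𝔰^≤)} − (1/2l)·log(q)` for "`C_Θ·|log(q)|`" — "where we apply the estimate
`(l+1)/4·(1/6)·(12/l²) ≥ 1/(2l)`" (and, from Step (vii), `(l+5)/4·log(π) ≤ (l+1)/4·4`).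
[claim: Mochizuki2012, status: disputed] -/
theorem stepviii_first (P : X.ProofData) :
    X.negLogTheta ≤
      ((X.l : ℝ) + 1) / 4 * ((1 + 12 * (X.dmod : ℝ) / X.l) * (X.logDiffTpd + X.logCondTpd)
        + 2 * Real.log X.l + 56 - 1 / 6 * (1 - 12 / ((X.l : ℝ) ^ 2)) * X.logq
        + 20 / 3 * X.lstar * P.logsLe) - 1 / (2 * (X.l : ℝ)) * X.logq := by
  have hl := X.five_le_l_real
  have hl0 : (0 : ℝ) < X.l := by linarith
  have h0 := P.hull_le
  have h3 := stepiii_final P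
  have hq := X.logq_pos
  -- Step (vii): `(l+5)/4·log(π) ≤ (l+1)/4·4`
  have hpi : ((X.l : ℝ) + 5) / 4 * Real.log Real.pi ≤ ((X.l : ℝ) + 1) / 4 * 4 := by
    have := log_pi_le_two
    have hpi0 : 0 ≤ Real.log Real.pi := Real.log_nonneg (by linarith [Real.pi_gt_three])
    nlinarith
  -- `(l+1)/4·(1/6)·(12/l²)·log(q) ≥ (1/2l)·log(q)`
  have hql : 1 / (2 * (X.l : ℝ)) * X.logq ≤ ((X.l : ℝ) + 1) / 4 * (1 / 6 * (12 / ((X.l : ℝ) ^ 2)) * X.logq) := by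
    have : 1 / (2 * (X.l : ℝ)) ≤ ((X.l : ℝ) + 1) / 4 * (1 / 6 * (12 / ((X.l : ℝ) ^ 2))) := by
      have hdiff : ((X.l : ℝ) + 1) / 4 * (1 / 6 * (12 / ((X.l : ℝ) ^ 2))) - 1 / (2 * (X.l : ℝ)) =
          1 / (2 * (X.l : ℝ) ^ 2) := by
        field_simp; ring
      have hpos : (0 : ℝ) ≤ 1 / (2 * (X.l : ℝ) ^ 2) := by positivity
      linarith
    calc 1 / (2 * (X.l : ℝ)) * X.logq ≤ ((X.l : ℝ) + 1) / 4 * (1 / 6 * (12 / ((X.l : ℝ) ^ 2))) * X.logq :=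
          mul_le_mul_of_nonneg_right this hq.le
      _ = _ := by ring
  have hc : 0 ≤ ((X.l : ℝ) + 1) / 4 := by positivity
  have h3' := mul_le_mul_of_nonneg_left h3 hc
  -- assemble (pure linear arithmetic once the products are named)
  have expand : ((X.l : ℝ) + 1) / 4 * ((1 + 4 / (X.l : ℝ)) * P.logDiffK - 1 / 6 * X.logq
        + 4 / (X.l : ℝ) * P.logsQ + 20 / 3 * X.lstar * P.logsLe) =
      ((X.l : ℝ) + 1) / 4 * ((1 + 4 / (X.l : ℝ)) * P.logDiffK + 4 / (X.l : ℝ) * P.logsQ)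
        - ((X.l : ℝ) + 1) / 4 * (1 / 6 * (1 - 12 / ((X.l : ℝ) ^ 2)) * X.logq)
        - ((X.l : ℝ) + 1) / 4 * (1 / 6 * (12 / ((X.l : ℝ) ^ 2)) * X.logq)
        + ((X.l : ℝ) + 1) / 4 * (20 / 3 * X.lstar * P.logsLe) := by ring
  rw [expand] at h0
  have expand2 : ((X.l : ℝ) + 1) / 4 * ((1 + 12 * (X.dmod : ℝ) / X.l) * (X.logDiffTpd + X.logCondTpd)
        + 2 * Real.log X.l + 56 - 1 / 6 * (1 - 12 / ((X.l : ℝ) ^ 2)) * X.logq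
        + 20 / 3 * X.lstar * P.logsLe) - 1 / (2 * (X.l : ℝ)) * X.logq =
      ((X.l : ℝ) + 1) / 4 * ((1 + 12 * (X.dmod : ℝ) / X.l) * (X.logDiffTpd + X.logCondTpd)
        + 2 * Real.log X.l + 52) + ((X.l : ℝ) + 1) / 4 * 4
        - ((X.l : ℝ) + 1) / 4 * (1 / 6 * (1 - 12 / ((X.l : ℝ) ^ 2)) * X.logq)
        - 1 / (2 * (X.l : ℝ)) * X.logq
        + ((X.l : ℝ) + 1) / 4 * (20 / 3 * X.lstar * P.logsLe) := by ring
  rw [expand2]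
  linarith

/-- Step (viii), application of Proposition 1.6 (pp. 30–31): `l*_mod·log(𝔰^≤) ≤ log(e*_mod·l)·Σ_{p ≤
e*_mod·l} 1 ≤ (4/3)·(e*_mod·l + η_prm)` "[i.e., regardless of the size of `e*_mod·l`]" — here `η_prm` is
any real number with the property of Prop. 1.6 (`IsEtaPrm`), which the tree proves to exist
(`exists_isEtaPrm`). [claim: Mochizuki2012, status: disputed] -/
theorem stepviii_pnt (P : X.ProofData) (hη : IsEtaPrm X.etaPrm) :
    X.lstar * P.logsLe ≤ 4 / 3 * ((X.estar : ℝ) * X.l + X.etaPrm) := by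
  have hl := X.five_le_l_real
  have he := X.estar_ge
  have hx1 : (1 : ℝ) ≤ (X.estar : ℝ) * X.l := by nlinarith
  have hlstar : 0 ≤ X.lstar := Real.log_nonneg hx1
  have h1 : X.lstar * P.logsLe ≤ X.lstar * (π (X.estar * X.l) : ℝ) :=
    mul_le_mul_of_nonneg_left P.sLe_le hlstar
  have h2 := log_mul_primeCounting_le_of_isEtaPrm hη (show (0 : ℝ) ≤ (X.estar : ℝ) * X.l by linarith)
  rw [show ⌊(X.estar : ℝ) * X.l⌋₊ = X.estar * X.l by exact_mod_cast Nat.floor_natCast (X.estar * X.l)]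
    at h2
  unfold lstar at h1 ⊢
  linarith

/-- Step (viii) (p. 31): "`(1/3)·(4/3)·(e*_mod·l + η_prm) ≥ (1/3)·(4/3)·e*_mod·l ≥ 2·2·2^12·3·5·l ≥ 2·log(l)
+ 56` — where we apply the estimates `e_mod ≥ 1`, `2^12·3·5 ≥ 56`, `l ≥ 5 ≥ 1`, `l ≥ log(l)`".
[claim: Mochizuki2012, status: disputed] -/
theorem stepviii_absorb (X : Thm110Numerics) :
    2 * Real.log X.l + 56 ≤ 1 / 3 * (4 / 3) * ((X.estar : ℝ) * X.l + X.etaPrm) := by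
  have hl := X.five_le_l_real
  have he := X.estar_ge
  have hη := X.etaPrm_pos
  have hl0 : (0 : ℝ) < X.l := by linarith
  have hlogl : Real.log (X.l : ℝ) ≤ X.l / 2 := by
    have := log_div_self_le_half hl0; rwa [div_le_iff₀ hl0, one_div_mul_eq_div] at this
  nlinarith

/-- **Steps (i)–(viii) assembled (p. 31)**: from the proof data and Prop. 1.6, `−|log(Θ)| ≤ C_Θ·|log(q)|`
for the PRINTED `C_Θ` — "substituting back into our original upper bound for “`C_Θ·|log(q)|`”, we obtain
the following upper bound for “`C_Θ`”: `(l+1)/(4·|log(q)|)·{(1 + 12·d_mod/l)·(log(𝔡^{F_tpd}) + log(𝔣^{F_tpd}))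
+ 10·(e*_mod·l + η_prm) − (1/6)·(1 − 12/l²)·log(q)} − 1` — where we apply the estimate `20 + (1/3)·(4/3)
= 7·(4/3) ≤ 10` [sic: `(20/3 + 1/3)·(4/3) = 28/3 ≤ 10`] — i.e., as asserted in the statement of Theorem
1.10." [claim: Mochizuki2012, status: disputed] -/
theorem cThetaAdmissible_of_proofData (P : X.ProofData) (hη : IsEtaPrm X.etaPrm) :
    X.CThetaAdmissible := by
  have hl := X.five_le_l_real
  have hl0 : (0 : ℝ) < X.l := by linarith
  have h1 := stepviii_first P
  have h2 := stepviii_pnt P hη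
  have h3 := stepviii_absorb X
  have hq := X.absLogq_pos
  have hc : 0 ≤ ((X.l : ℝ) + 1) / 4 := by positivity
  -- the braces after PNT + absorption: `2 log l + 56 + (20/3)·l*·log(𝔰^≤) ≤ 10·(e* l + η)`
  have hbr : 2 * Real.log X.l + 56 + 20 / 3 * X.lstar * P.logsLe ≤
      10 * ((X.estar : ℝ) * X.l + X.etaPrm) := by
    have he := X.estar_ge; have := X.etaPrm_pos
    nlinarith
  have hmono : ((X.l : ℝ) + 1) / 4 * ((1 + 12 * (X.dmod : ℝ) / X.l) * (X.logDiffTpd + X.logCondTpd)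
        + 2 * Real.log X.l + 56 - 1 / 6 * (1 - 12 / ((X.l : ℝ) ^ 2)) * X.logq
        + 20 / 3 * X.lstar * P.logsLe) ≤ ((X.l : ℝ) + 1) / 4 * X.bracket := by
    apply mul_le_mul_of_nonneg_left _ hc
    unfold bracket; linarith
  unfold CThetaAdmissible CTheta
  have e1 : (((X.l : ℝ) + 1) / (4 * X.absLogq) * X.bracket - 1) * X.absLogq =
      ((X.l : ℝ) + 1) / 4 * X.bracket - X.absLogq := by
    field_simp
  rw [e1]
  have e2 : X.absLogq = 1 / (2 * (X.l : ℝ)) * X.logq := by unfold absLogq; ring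
  rw [e2] at *
  linarith

/-! ## From `C_Θ ≥ −1` to the displayed inequalities (pp. 23, 31) -/

/-- "`C_Θ ≥ −1` for any real number `C_Θ ∈ ℝ` such that `−|log(Θ)| ≤ C_Θ·|log(q)|`" ([IUTchIII] Cor. 3.12,
as recalled on p. 23) — for the printed `C_Θ`: admissibility together with the HYPOTHESIS `Cor312` gives
`−1 ≤ C_Θ` (divide by `|log(q)| > 0`). [claim: Mochizuki2012, status: disputed] -/
theorem neg_one_le_CTheta (h1 : X.CThetaAdmissible) (h2 : X.Cor312) : -1 ≤ X.CTheta := by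
  unfold CThetaAdmissible at h1; unfold Cor312 at h2
  have hq := X.absLogq_pos
  have h : -X.absLogq ≤ X.CTheta * X.absLogq := le_trans h2 h1
  by_contra hlt
  rw [not_le] at hlt
  have : X.CTheta * X.absLogq < -1 * X.absLogq := mul_lt_mul_of_pos_right hlt hq
  linarith

/-- `C_Θ ≥ −1` unpacks (the braces are nonnegative) to `(1/6)·(1 − 12/l²)·log(q) ≤ (1 + 12·d_mod/l)·
(log(𝔡^{F_tpd}) + log(𝔣^{F_tpd})) + 10·(e*_mod·l + η_prm)` — "the inequality of the first display of Step
(ii)" of p. 31 refers to this rearrangement. [claim: Mochizuki2012, status: disputed] -/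
theorem bracket_nonneg_of_neg_one_le_CTheta (h : -1 ≤ X.CTheta) : 0 ≤ X.bracket := by
  unfold CTheta at h
  have hq := X.absLogq_pos
  have hl := X.five_le_l_real
  have hc : 0 < ((X.l : ℝ) + 1) / (4 * X.absLogq) := by positivity
  have h0 : 0 ≤ ((X.l : ℝ) + 1) / (4 * X.absLogq) * X.bracket := by linarith
  by_contra hb
  rw [not_le] at hb
  have : ((X.l : ℝ) + 1) / (4 * X.absLogq) * X.bracket < 0 := mul_neg_of_pos_of_neg hc hb
  linarith

/-- **Last paragraph of the proof (p. 31)**: `C_Θ ≥ −1 ⟹` the first display of Theorem 1.10,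
`(1/6)·log(q) ≤ (1 + 20·d_mod/l)·(log(𝔡^{F_tpd}) + log(𝔣^{F_tpd})) + 20·(e*_mod·l + η_prm)`, "by applying …
the estimates `(1 − 12/l²)⁻¹ ≤ 2`; `(1 − 12/l²)⁻¹·(1 + 12·d_mod/l) ≤ 1 + 20·d_mod/l` [cf. the fact that `l ≥ 7`,
`d_mod ≥ 1`]". The second estimate is `0 ≤ t·(8d − 12t − 240d·t²)` with `t = 1/l`, false at `l = 5`.
[claim: Mochizuki2012, status: disputed] -/
theorem display_of_neg_one_le_CTheta (h7 : 7 ≤ X.l) (h : -1 ≤ X.CTheta) : X.Display := by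
  have hb := bracket_nonneg_of_neg_one_le_CTheta h
  unfold bracket at hb
  unfold Display
  have h7r : (7 : ℝ) ≤ X.l := by exact_mod_cast h7
  have hd : (1 : ℝ) ≤ X.dmod := by exact_mod_cast X.one_le_dmod
  have hl0 : (0 : ℝ) < X.l := by linarith
  have hL : 0 ≤ X.logDiffTpd + X.logCondTpd := add_nonneg X.logDiffTpd_nonneg X.logCondTpd_nonneg
  have hE : 0 ≤ (X.estar : ℝ) * X.l + X.etaPrm := by
    have := X.estar_ge; have := X.etaPrm_pos; positivity
  have hq := X.logq_pos
  set t : ℝ := 1 / (X.l : ℝ) with ht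
  have ht0 : 0 < t := by rw [ht]; positivity
  have ht7 : t ≤ 1 / 7 := by rw [ht]; exact one_div_le_one_div_of_le (by norm_num) h7r
  have e1 : 12 * (X.dmod : ℝ) / X.l = 12 * X.dmod * t := by rw [ht]; ring
  have e2 : 12 / ((X.l : ℝ) ^ 2) = 12 * t ^ 2 := by rw [ht]; field_simp
  have e3 : 20 * (X.dmod : ℝ) / X.l = 20 * X.dmod * t := by rw [ht]; ring
  rw [e1, e2] at hb
  rw [e3]
  have hden : 0 < 1 - 12 * t ^ 2 := by nlinarith
  have hstep : 1 / 6 * X.logq * (1 - 12 * t ^ 2) ≤ (1 + 12 * X.dmod * t) * (X.logDiffTpd + X.logCondTpd)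
      + 10 * ((X.estar : ℝ) * X.l + X.etaPrm) := by linarith
  have hc1 : (1 + 12 * (X.dmod : ℝ) * t) ≤ (1 + 20 * X.dmod * t) * (1 - 12 * t ^ 2) := by
    have ht2 : t ^ 2 ≤ 1 / 49 := by nlinarith
    have hA : 240 * (X.dmod : ℝ) * t ^ 2 ≤ 240 * X.dmod * (1 / 49) :=
      mul_le_mul_of_nonneg_left ht2 (by positivity)
    have hpos : 0 ≤ 8 * (X.dmod : ℝ) - 12 * t - 240 * X.dmod * t ^ 2 := by linarith
    have hprod := mul_nonneg (le_of_lt ht0) hpos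
    have expand : (1 + 20 * (X.dmod : ℝ) * t) * (1 - 12 * t ^ 2) - (1 + 12 * X.dmod * t) =
        t * (8 * X.dmod - 12 * t - 240 * X.dmod * t ^ 2) := by ring
    linarith
  have hc2 : (10 : ℝ) ≤ 20 * (1 - 12 * t ^ 2) := by nlinarith
  have key : (1 + 12 * (X.dmod : ℝ) * t) * (X.logDiffTpd + X.logCondTpd)
      + 10 * ((X.estar : ℝ) * X.l + X.etaPrm) ≤
      ((1 + 20 * X.dmod * t) * (X.logDiffTpd + X.logCondTpd) + 20 * ((X.estar : ℝ) * X.l + X.etaPrm))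
        * (1 - 12 * t ^ 2) := by
    have a1 := mul_le_mul_of_nonneg_right hc1 hL
    have a2 := mul_le_mul_of_nonneg_right hc2 hE
    have expand : ((1 + 20 * (X.dmod : ℝ) * t) * (X.logDiffTpd + X.logCondTpd)
        + 20 * ((X.estar : ℝ) * X.l + X.etaPrm)) * (1 - 12 * t ^ 2) =
        (1 + 20 * X.dmod * t) * (1 - 12 * t ^ 2) * (X.logDiffTpd + X.logCondTpd)
        + 20 * (1 - 12 * t ^ 2) * ((X.estar : ℝ) * X.l + X.etaPrm) := by ring
    rw [expand]
    linarith
  have : 1 / 6 * X.logq * (1 - 12 * t ^ 2) ≤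
      ((1 + 20 * X.dmod * t) * (X.logDiffTpd + X.logCondTpd) + 20 * ((X.estar : ℝ) * X.l + X.etaPrm))
        * (1 - 12 * t ^ 2) := le_trans hstep key
  exact le_of_mul_le_mul_right this hden

/-- The second display of Theorem 1.10 from the first, "by applying the inequality of the first display
of Step (ii)" (p. 31), i.e. `log(𝔡^{F_tpd}) + log(𝔣^{F_tpd}) ≤ log(𝔡^F) + log(𝔣^F)`.
[claim: Mochizuki2012, status: disputed] -/
theorem displayF_of_display (P : X.ProofData) (h : X.Display) : X.DisplayF := by
  unfold Display at h; unfold DisplayF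
  have hl := X.five_le_l_real
  have h1 := P.tpd_le_F
  have hc : 0 ≤ 1 + 20 * (X.dmod : ℝ) / X.l := by positivity
  have := mul_le_mul_of_nonneg_left h1 hc
  linarith

/-- **[IUTchIV] Theorem 1.10, as a kernel-checked implication.** For numerics `X` of a collection of
initial Θ-data with `η_prm` the positive real number of Proposition 1.6 (`IsEtaPrm`, proved to exist),
proof data `P` (the log-volume bounds of Steps (iv)–(vii) and the Prop. 1.3/1.8-based inequalities of
Steps (ii)–(iii), as printed), the printed `l ≠ 5`, and the HYPOTHESIS `Cor312` ([IUTchIII] Cor. 3.12 for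
these data): (a) one may take `C_Θ` to be the printed constant (`CThetaAdmissible`), (b) `C_Θ ≥ −1`, and
(c) both displayed inequalities `(1/6)·log(q) ≤ (1 + 20·d_mod/l)·(log(𝔡^{F_tpd}) + log(𝔣^{F_tpd})) +
20·(e*_mod·l + η_prm) ≤ (1 + 20·d_mod/l)·(log(𝔡^F) + log(𝔣^F)) + 20·(e*_mod·l + η_prm)` hold. Nothing is
asserted unconditionally about any elliptic curve. [claim: Mochizuki2012, status: disputed] -/
theorem theorem110 (P : X.ProofData) (hη : IsEtaPrm X.etaPrm) (hne : X.l ≠ 5) (hcor : X.Cor312) :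
    X.CThetaAdmissible ∧ -1 ≤ X.CTheta ∧ X.Display ∧ X.DisplayF := by
  have ha := cThetaAdmissible_of_proofData P hη
  have hC := neg_one_le_CTheta ha hcor
  have hD := display_of_neg_one_le_CTheta (X.seven_le_l_of_ne_five hne) hC
  exact ⟨ha, hC, hD, displayF_of_display P hD⟩

end Thm110Numerics

end Literature.IUT.LogVolume

end
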